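import Mathlib.Topology.Algebra.ClopenNhdofOne
import Mathlib.Topology.Algebra.OpenSubgroup
import Mathlib.Topology.Algebra.Group.Quotient
import Mathlib.Topology.Algebra.ContinuousMonoidHom
import Mathlib.Data.Nat.Factors
import Literature.AnabelianGeometry.SemiGraphs.PSCFundamentalGroup
import Literature.AnabelianGeometry.AbsoluteAnabelian.FreeProlCyclicEncoding
import HarnessLib

/-!
# Pro-`Σ` groups: quotients, images, subgroups, open-subgroup indices

[CombGC] (S. Mochizuki, *A combinatorial version of the Grothendieck conjecture*, Tohoku Math. J. 59
(2007)) Def. 1.1 (ii) p. 6 works with "the maximal pro-Σ quotient of the profinite fundamental group"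
and passes freely between `Π_G`, its open subgroups ("finite étale `Π_G`-coverings", Def. 1.2;
Thm. 1.6 proof p. 13 "stabilizers of cusps of finite étale coverings of `G`, `H`"), and its quotients
("the compactification", Rmk. 1.1.6 p. 8; "we may assume without loss of generality that `Σ = {l}`",
p. 13 = the maximal pro-`l` quotient).  abc-iut-L3's interface `SemiGraphs.PSCDatum` records
pro-`Σ`-ness as the field `proSigma : IsProSigma Σ Π_G`; the three interface functors planned for
[CombGC] Thm. 1.6 (`PSCDatum.restrict` to an open subgroup, `PSCDatum.compactify`, `PSCDatum.proL`
— `plan/L3/SUBDAG-CombGC-Thm16.md` rows T16-L04/L09, GAP-LEDGER G-w4d052-1) each owe that field for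
a NEW carrier (`↥U`, `Π ⧸ K`); `restrict` and its open-finite-index `proSigma` lemma are
abc-iut-L3-t4's (`PSCCoveringDatum`).  This proof-only file (no definitions) supplies the rest of the
`IsProSigma` API (OFFER 02:15Z, owner GO abc-iut-L3-t4 g4 02:17:31Z):

* `IsProSigma.of_surjective` — the image of a pro-`Σ` group under a continuous surjective
  homomorphism is pro-`Σ`; hence `IsProSigma.quotient` (any normal subgroup, quotient topology)
  and `IsProSigma.of_continuousMulEquiv` (transport);
* `IsProSigma.subgroup` — EVERY subgroup of a compact totally disconnected pro-`Σ` group is pro-`Σ`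
  in the subspace topology (via abc-iut-L4-t6's `isSigmaInteger_index_of_isOpen_of_isProSigma`);
* `IsProSigma.isSigmaInteger_index` / `index_eq_pow` — every OPEN subgroup (normal or not) of a
  compact totally disconnected pro-`Σ` group has `Σ`-integer index (a power of `l` when `Σ = {l}`);
* `IsProSigma.mono` — monotone in `Σ`.

Classical profinite group theory; HONEST FRAMING: nothing here bears on [IUTchIII] Cor. 3.12;
typed ≠ proved elsewhere.
-/

noncomputable section

namespace Literature.AnabelianGeometry.SemiGraphs

open Literature.AnabelianGeometry.Anabelioids (IsSigmaInteger)

universe u v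

variable {P : Type u} [Group P] [TopologicalSpace P]

namespace IsProSigma

/-- Pro-`Σ` is monotone in `Σ`. [cite: MochizukiCombGC2007, Def 1.1(ii) p.6] -/
theorem mono {S S' : Set ℕ} (hSS' : S ⊆ S') (hP : IsProSigma S P) : IsProSigma S' P :=
  ⟨fun U hU p hp hpd => hSS' (hP.prime_mem U hU p hp hpd)⟩

/-- **The image of a pro-`Σ` group under a continuous surjective homomorphism is pro-`Σ`**: an open
normal `W ⊴ Q` pulls back to an open normal `f⁻¹(W) ⊴ Π` with `[Π : f⁻¹(W)] = [Q : W]`.  (A copy at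
the `SemiGraphs` level of abc-iut-L5's `Literature.IUT.HodgeTheaters.isProSigma_of_surjective`
(`TemperedCoveringsCompactSubgroups.lean`), which layer L3 cannot import — cf. that file.)
[cite: MochizukiCombGC2007, Def 1.1(ii) p.6] -/
theorem of_surjective {Q : Type v} [Group Q] [TopologicalSpace Q] {S : Set ℕ}
    (hP : IsProSigma S P) (f : P →* Q) (hf : Continuous f) (hs : Function.Surjective f) :
    IsProSigma S Q := by
  refine ⟨fun W hW p hp hpd => ?_⟩
  -- the preimage of `W`, an open normal subgroup of `Π`
  let W' : OpenNormalSubgroup P :=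
    { toSubgroup := W.toSubgroup.comap f
      isOpen' := W.toOpenSubgroup.isOpen.preimage hf
      isNormal' := Subgroup.normal_comap f }
  have hidx : W'.toSubgroup.index = W.toSubgroup.index :=
    Subgroup.index_comap_of_surjective W.toSubgroup hs
  have hcardQ : Nat.card (Q ⧸ W.toSubgroup) ≠ 0 := by
    rw [← Subgroup.index_eq_card]
    haveI : W.toSubgroup.FiniteIndex := Subgroup.finiteIndex_of_finite_quotient
    exact Subgroup.FiniteIndex.index_ne_zero
  have hcardP : Nat.card (P ⧸ W'.toSubgroup) = Nat.card (Q ⧸ W.toSubgroup) := by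
    rw [← Subgroup.index_eq_card, ← Subgroup.index_eq_card, hidx]
  haveI : Finite (P ⧸ W'.toSubgroup) := Nat.finite_of_card_ne_zero (hcardP ▸ hcardQ)
  exact hP.prime_mem W' inferInstance p hp (hcardP ▸ hpd)

/-- **Quotients of pro-`Σ` groups are pro-`Σ`** (quotient topology; any normal subgroup) — the
`proSigma` obligation of quotient data such as the compactification `Π_G ↠ Π_G^cpt` (Rmk. 1.1.6)
or the maximal pro-`l` quotient. [cite: MochizukiCombGC2007, Rmk 1.1.6 p.8] -/
theorem quotient [IsTopologicalGroup P] {S : Set ℕ} (hP : IsProSigma S P) (K : Subgroup P)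
    [K.Normal] : IsProSigma S (P ⧸ K) :=
  hP.of_surjective (QuotientGroup.mk' K) QuotientGroup.continuous_mk (QuotientGroup.mk'_surjective K)

/-- Pro-`Σ` is transported along isomorphisms of topological groups.
[cite: MochizukiCombGC2007, Def 1.1(ii) p.6] -/
theorem of_continuousMulEquiv {P' : Type v} [Group P'] [TopologicalSpace P'] {S : Set ℕ}
    (hP : IsProSigma S P) (e : P ≃ₜ* P') : IsProSigma S P' :=
  hP.of_surjective e.toMulEquiv.toMonoidHom e.toHomeomorph.continuous e.surjective

/-- **Every subgroup of a compact totally disconnected pro-`Σ` group is pro-`Σ`** (subspace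
topology): an open subgroup `H` of `A ⊆ Π` contains `U ∩ A` for an open normal `U ⊴ Π`, and
`[A : H] ∣ [A : U ∩ A] ∣ [Π : U]` (abc-iut-L4-t6's `isSigmaInteger_index_of_isOpen_of_isProSigma`)
— for ARBITRARY subgroups of a profinite pro-`Σ` group (the open finite-index case without
compactness is abc-iut-L3-t4's `PSCDatum.isProSigma_subgroup`, PSCCoveringDatum; cf. also
abc-iut-L5's `Literature.IUT.HodgeTheaters.isProSigma_subgroup`, not importable here).
[cite: MochizukiCombGC2007, Def 1.2 p.9] -/
theorem subgroup [IsTopologicalGroup P] [CompactSpace P] [TotallyDisconnectedSpace P] {S : Set ℕ}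
    (hP : IsProSigma S P) (A : Subgroup P) : IsProSigma S ↥A :=
  ⟨fun W _ p hp hpd =>
    (AbsoluteAnabelian.isSigmaInteger_index_of_isOpen_of_isProSigma hP A W.toSubgroup
        W.toOpenSubgroup.isOpen).2 p hp (by rwa [Subgroup.index_eq_card])⟩

/-- **Every open subgroup of a compact totally disconnected pro-`Σ` group has `Σ`-integer index**
(normal or not: it contains an open NORMAL subgroup, whose index it divides).
[cite: MochizukiCombGC2007, Def 1.1(ii) p.6] -/
theorem isSigmaInteger_index [IsTopologicalGroup P] [CompactSpace P] [TotallyDisconnectedSpace P]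
    {S : Set ℕ} (hP : IsProSigma S P) (U : Subgroup P) (hU : IsOpen (U : Set P)) :
    IsSigmaInteger S U.index := by
  obtain ⟨N, hN⟩ := ProfiniteGrp.exist_openNormalSubgroup_sub_open_nhds_of_one hU U.one_mem
  have hle : N.toSubgroup ≤ U := fun x hx => hN hx
  haveI : Finite (P ⧸ N.toSubgroup) :=
    Subgroup.quotient_finite_of_isOpen N.toSubgroup N.toOpenSubgroup.isOpen
  haveI : N.toSubgroup.FiniteIndex := Subgroup.finiteIndex_of_finite_quotient
  have hdvd : U.index ∣ N.toSubgroup.index := Subgroup.index_dvd_of_le hle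
  refine ⟨Nat.pos_of_dvd_of_pos hdvd (Nat.pos_of_ne_zero Subgroup.FiniteIndex.index_ne_zero),
    fun p hp hpd => ?_⟩
  exact hP.prime_mem N inferInstance p hp (by rw [← Subgroup.index_eq_card]; exact hpd.trans hdvd)

/-- In a compact totally disconnected pro-`l` group (`l` prime), every open subgroup has index a
power of `l` (cf. abc-iut-L3's `PSCDatum.index_eq_pow_of_sigma_eq` for NORMAL open subgroups of a
PSC datum with `Σ = {l}`). [cite: MochizukiCombGC2007, Def 1.1(ii) p.6] -/
theorem index_eq_pow [IsTopologicalGroup P] [CompactSpace P] [TotallyDisconnectedSpace P]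
    {l : ℕ} (hP : IsProSigma {l} P) (U : Subgroup P) (hU : IsOpen (U : Set P)) :
    ∃ m : ℕ, U.index = l ^ m := by
  have h := hP.isSigmaInteger_index U hU
  exact ⟨_, Nat.eq_prime_pow_of_unique_prime_dvd h.1.ne'
    fun hd hdn => Set.mem_singleton_iff.mp (h.2 _ hd hdn)⟩

/-- An open subgroup of a compact totally disconnected pro-`Σ` group has FINITE index (recorded with
the `Σ`-integer statement for convenience). [cite: MochizukiCombGC2007, Def 1.1(ii) p.6] -/
theorem finiteIndex_of_isOpen [IsTopologicalGroup P] [CompactSpace P] [TotallyDisconnectedSpace P]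
    {S : Set ℕ} (hP : IsProSigma S P) (U : Subgroup P) (hU : IsOpen (U : Set P)) :
    U.FiniteIndex :=
  ⟨(hP.isSigmaInteger_index U hU).1.ne'⟩

end IsProSigma

namespace PSCDatum

variable [IsTopologicalGroup P] (G : PSCDatum P)

/-- For a PSC datum on a profinite `Π_G` (compact, totally disconnected), EVERY subgroup of `Π_G` is
pro-`Σ_G` in the subspace topology (abc-iut-L3-t4's `PSCDatum.isProSigma_subgroup` is the open
finite-index form without compactness, used by `PSCDatum.restrict`).
[cite: MochizukiCombGC2007, Def 1.2 p.9] -/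
theorem isProSigma_of_subgroup [CompactSpace P] [TotallyDisconnectedSpace P] (A : Subgroup P) :
    IsProSigma G.Sigma ↥A :=
  G.proSigma.subgroup A

/-- For a PSC datum, every quotient `Π_G ⧸ K` (`K` normal, quotient topology) is pro-`Σ_G` — the
`proSigma` field of quotient data (compactification, maximal pro-`l` quotient with `Σ ⊇ {l}` then
`IsProSigma.mono`). [cite: MochizukiCombGC2007, Rmk 1.1.6 p.8] -/
theorem isProSigma_quotient (K : Subgroup P) [K.Normal] : IsProSigma G.Sigma (P ⧸ K) :=
  G.proSigma.quotient K

/-- For a PSC datum, every open subgroup of `Π_G` has `Σ_G`-integer index.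
[cite: MochizukiCombGC2007, Def 1.1(ii) p.6] -/
theorem isSigmaInteger_index_of_isOpen [CompactSpace P] [TotallyDisconnectedSpace P]
    (U : Subgroup P) (hU : IsOpen (U : Set P)) : IsSigmaInteger G.Sigma U.index :=
  G.proSigma.isSigmaInteger_index U hU

end PSCDatum

end Literature.AnabelianGeometry.SemiGraphs

end
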